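import Mathlib
import Summits.ValiantsHypothesis.ValiantsHypothesis.Theorems.ShallowShadowsShadowFormulaTransferShadowOfArithExpr

/-!
# Crux `ShallowShadows.ShadowFormulaTransfer` (stmt-ValiantsHypothesis-17124), line
# `Sketch-ideator1` — the registered stub `stub_shadowMulDominated`

The SHADOW of a polynomial `p` is the monotone Boolean function
`B p : a ↦ [∃ m ∈ supp p, supp m ⊆ {i | a i}]`. Over the semiring `ℝ≥0` there is no cancellation,
so `B (p · Q) = B p ∧ B Q` (`nnshadow_mul_iff`, sibling file `…ShadowOfArithExpr`). Hence for a
shadow-dominated cofactor `Q` (`B p ≤ B Q`, e.g. `Q` with a constant term) the shadow of the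
multiple `p · Q` is the shadow of `p` itself: `B (p · Q) = B p`. This is the rule that lets the
composition `ShadowFormulaTransfer_of` read the shadow of `f` off a monotone formula for a
multiple `lift(f) · Q` (certificate kind (M)).

Main result: `stub_shadowMulDominated`.
-/

-- Sub = Summit single-conjunct layout: the duplicated namespace component is mandated by the tree.
set_option linter.dupNamespace false

noncomputable section

namespace Summit.ValiantsHypothesis.ValiantsHypothesis.Theorems.ShallowShadowsShadowFormulaTransfer

open scoped NNReal

/-- **Stub `ShadowMulDominated`.** Over `ℝ≥0`, if the shadow of `p` is dominated by the shadow of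
`Q` (`B p ≤ B Q` pointwise), then the shadow of the product `p · Q` equals the shadow of `p`:
`B (p · Q) = B p ∧ B Q = B p` (no cancellation, `nnshadow_mul_iff`). [folklore] -/
theorem stub_shadowMulDominated :
    ∀ (ι : Type) (p Q : MvPolynomial ι ℝ≥0),
      (∀ a : ι → Bool, (∃ m ∈ p.support, ∀ i ∈ m.support, a i = true) →
        ∃ m ∈ Q.support, ∀ i ∈ m.support, a i = true) →
      ∀ a : ι → Bool, (∃ m ∈ (p * Q).support, ∀ i ∈ m.support, a i = true) ↔
        ∃ m ∈ p.support, ∀ i ∈ m.support, a i = true := by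
  intro ι p Q hdom a
  rw [nnshadow_mul_iff]
  exact ⟨fun h => h.1, fun h => ⟨h, hdom a h⟩⟩

end Summit.ValiantsHypothesis.ValiantsHypothesis.Theorems.ShallowShadowsShadowFormulaTransfer

end
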